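import Literature.Computability.AlgebraicComplexity.AsymptoticRankZariskiClosedProofs

/-!
# `FidelityWitnesses.FidelityGapTwoSix`, line `closure-transfer` — the rank locus is a complex cone

Support file for crux item `stmt-MatrixMultiplication-4957`
(`Summit.MatrixMultiplication.MatrixMultiplication.Theses.FidelityWitnesses.FidelityGapTwoSix`), line
`closure-transfer`, stub `stub_rankConeSmul`: scaling a tensor by a complex number does not raise its
tensor rank, `R(c • S) ≤ R(S)`.  Hence every sublevel set `{S | R(S) ≤ r}` of
`Literature.Computability.AlgebraicComplexity.tensorRank` is stable under `S ↦ c • S` (all `c : ℂ`,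
phases and `c = 0` included), which is the cone hypothesis fed to the closure criterion of the line
(composition `(stub_rankConeSmul c S).trans hS : tensorRank (c • S) ≤ 6`).

The statement is the specialisation to `K = ℂ` and index types in `Type` of the tree lemma
`Literature.Computability.AlgebraicComplexity.tensorRank_smul_le` (scale the first vector of each
triad of an optimal decomposition; Bläser 2013, §4; Bürgisser–Clausen–Shokrollahi 1997, §14), and is
proved by invoking it.  Nothing else is in this file.
-/

namespace Summit.MatrixMultiplication.MatrixMultiplication.Theorems

open Literature.Computability.AlgebraicComplexity

/-- **The rank locus is a complex cone** (stub `stub_rankConeSmul` of line `closure-transfer` for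
`FidelityGapTwoSix`): for a tensor `S : ι → κ → μ → ℂ` of finite format and any scalar `c : ℂ`,
`tensorRank (c • S) ≤ tensorRank S` — scaling (in particular rephasing, or killing with `c = 0`) a
tensor does not increase its rank, so `{S | tensorRank S ≤ r}` is stable under `S ↦ c • S`.
Proof: the tree lemma `tensorRank_smul_le` (an optimal triad decomposition
`S = Σ_i w_i ⊗ u_i ⊗ v_i` gives `c • S = Σ_i (c • w_i) ⊗ u_i ⊗ v_i`).  (Bläser 2013, §4.) -/
theorem stub_rankConeSmul {ι κ μ : Type} [Fintype ι] [Fintype κ] [Fintype μ]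
    (c : ℂ) (S : ι → κ → μ → ℂ) : tensorRank (c • S) ≤ tensorRank S :=
  tensorRank_smul_le c S

end Summit.MatrixMultiplication.MatrixMultiplication.Theorems
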